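import Literature.InformationTheory.QuantumCodes.RandomCSSCodesErasure
import HarnessLib

/-!
# CSS codes achieve the quantum ERASURE-channel capacity `Q = 1 − 2ε` (Bennett–DiVincenzo–Smolin), and no CSS family
# with `k ≥ 1` does better: the SAME erased set for both sectors

Topic `Literature/InformationTheory/QuantumCodes` (venture QEC, LADDER-QEC rung Q5; qec-lit-2 gen 6). Theorem-only;
no definition, no named fact, no `sorry`.

**Printed statement.** Bennett–DiVincenzo–Smolin 1997, p. 3218: for the quantum erasure channel (each qubit erased,
at a known position, with probability `ε`) `Q = max{0, 1 − 2ε}`; "two bits of redundancy per erased qubit are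
necessary and sufficient … to recover the phase and amplitude of all erased qubits with probability tending to 1
in the limit of large block size" (sufficiency by random hash codes = random linear stabilizer codes, footnote cf2).

The tree states the erasure model SECTOR-WISE (`Z`-sector pattern uncorrectable iff a `Z`-logical lives inside it;
`CSSErasureCapacityConverse.lean`, `RandomCSSCodesErasure.lean`, with independent loss rates `y_Z`, `y_X`). The
genuine quantum erasure channel erases ONE set `E ~ Ber(ε)` of qubits, lost for BOTH sectors: a CSS code recovers iff
`E` is correctable for the `Z`-sector AND for the `X`-sector. This file states that joint event (inline, via
`eventProb`; no new definition) and proves both halves of `Q_CSS = 1 − 2ε`: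

* `CSSCode.quantumErasureFailure_le_add` / `zUncorrectableProb_le_quantumErasureFailure` /
  `xUncorrectableProb_le_quantumErasureFailure` — union bound and marginals:
  `max(P^Z_ε, P^X_ε) ≤ P_ε[joint failure] ≤ P^Z_ε + P^X_ε`;
* **achievability** `exists_cssFamily_quantumErasure_tendsto_zero`: for `0 < ε`, `0 ≤ R`, `2ε < 1 − R` there are
  CSS codes `C_n` (random, `⌊ρ n⌋` checks of each kind, `ρ = (1 − R)/2`) with `k_n ≥ R n` whose joint-failure
  probability on the erasure channel tends to `0` at every erasure rate `0 ≤ ε' ≤ ε` — every rate `R < 1 − 2ε` is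
  achieved by CSS codes;
* **converse** `quantumErasure_rate_le`: for every CSS family with `k_i ≥ 1` and `R·n_i ≤ k_i`, if the joint
  failure probability at erasure rate `ε ∈ [0, 1/2]` tends to `0` then `2ε ≤ 1 − R` (from the sector-wise ceiling
  `erasure_rates_add_le_one_sub_rate`); threshold form `quantumErasure_threshold_le_half_sub_rate`.

Not claimed: non-CSS stabilizer codes; efficient decoding; finite-size constants beyond those of
`RandomCSSCodesErasure.lean`; numbers.

## References

* [BennettDivincenzoSmolin1997] C. H. Bennett, D. P. DiVincenzo, J. A. Smolin, PRL 78 (1997) 3217 =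
  arXiv:quant-ph/9701015, p. 3218 (chunk p0003 L59–83: `Q = max{0, 1 − 2ε}`, "necessary and sufficient";
  p0006 L43 footnote cf2: "identical to random linear stabilizer codes").
* [DelfosseZemor2013] N. Delfosse, G. Zémor, QIC 13 (2013) 793, §3 (`R ≤ 1 − 2p` for stabilizer codes).
* [DennisEtAl2002] E. Dennis, A. Kitaev, A. Landahl, J. Preskill, J. Math. Phys. 43 (2002) 4452, §4.3 (below
  threshold), §4.6 (`p_c`).
-/

namespace Literature.InformationTheory.QuantumCodes

open Finset Matrix Filter Topology

/-! ### One code: the joint failure event versus the two sectors -/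

namespace CSSCode

variable {RX RZ V : Type*} [Fintype V] [Fintype RX] [Fintype RZ]

open Classical in
/-- **Union bound**: the probability that the erased set is uncorrectable for the `Z`-sector OR for the `X`-sector is
at most `P^Z_ε + P^X_ε` (`0 ≤ ε ≤ 1`). [cite: BennettDivincenzoSmolin1997, p. 3218 (recover the phase and amplitude of all erased qubits)] -/
theorem quantumErasureFailure_le_add (C : CSSCode RX RZ V) {ε : ℝ} (h0 : 0 ≤ ε) (h1 : ε ≤ 1) :
    eventProb (fun E : Finset V =>
        ¬ IsCorrectableErasure {x : V → ZMod 2 | C.HX *ᵥ x = 0} (C.rowSpZ : Set (V → ZMod 2)) E ∨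
          ¬ IsCorrectableErasure {x : V → ZMod 2 | C.HZ *ᵥ x = 0} (C.rowSpX : Set (V → ZMod 2)) E) ε ≤
      ErasureDecoder.uncorrectableProb {x : V → ZMod 2 | C.HX *ᵥ x = 0} (C.rowSpZ : Set (V → ZMod 2)) ε +
        ErasureDecoder.uncorrectableProb {x : V → ZMod 2 | C.HZ *ᵥ x = 0} (C.rowSpX : Set (V → ZMod 2)) ε := by
  unfold ErasureDecoder.uncorrectableProb
  exact eventProb_or_le _ _ h0 h1

open Classical in
/-- The `Z`-sector marginal: `P^Z_ε ≤ P_ε[joint failure]` (`0 ≤ ε ≤ 1`).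
[cite: BennettDivincenzoSmolin1997, p. 3218; DelfosseZemor2013, §3] -/
theorem zUncorrectableProb_le_quantumErasureFailure (C : CSSCode RX RZ V) {ε : ℝ} (h0 : 0 ≤ ε) (h1 : ε ≤ 1) :
    ErasureDecoder.uncorrectableProb {x : V → ZMod 2 | C.HX *ᵥ x = 0} (C.rowSpZ : Set (V → ZMod 2)) ε ≤
      eventProb (fun E : Finset V =>
        ¬ IsCorrectableErasure {x : V → ZMod 2 | C.HX *ᵥ x = 0} (C.rowSpZ : Set (V → ZMod 2)) E ∨
          ¬ IsCorrectableErasure {x : V → ZMod 2 | C.HZ *ᵥ x = 0} (C.rowSpX : Set (V → ZMod 2)) E) ε := by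
  unfold ErasureDecoder.uncorrectableProb
  exact eventProb_mono (fun E hE => Or.inl hE) h0 h1

open Classical in
/-- The `X`-sector marginal: `P^X_ε ≤ P_ε[joint failure]` (`0 ≤ ε ≤ 1`).
[cite: BennettDivincenzoSmolin1997, p. 3218; DelfosseZemor2013, §3] -/
theorem xUncorrectableProb_le_quantumErasureFailure (C : CSSCode RX RZ V) {ε : ℝ} (h0 : 0 ≤ ε) (h1 : ε ≤ 1) :
    ErasureDecoder.uncorrectableProb {x : V → ZMod 2 | C.HZ *ᵥ x = 0} (C.rowSpX : Set (V → ZMod 2)) ε ≤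
      eventProb (fun E : Finset V =>
        ¬ IsCorrectableErasure {x : V → ZMod 2 | C.HX *ᵥ x = 0} (C.rowSpZ : Set (V → ZMod 2)) E ∨
          ¬ IsCorrectableErasure {x : V → ZMod 2 | C.HZ *ᵥ x = 0} (C.rowSpX : Set (V → ZMod 2)) E) ε := by
  unfold ErasureDecoder.uncorrectableProb
  exact eventProb_mono (fun E hE => Or.inr hE) h0 h1

end CSSCode

/-! ### Achievability: every rate below `1 − 2ε` -/

section Achievability

open Classical in
/-- **CSS CODES ACHIEVE THE ERASURE CAPACITY `1 − 2ε`.** For `0 < ε`, `0 ≤ R` and `2ε < 1 − R` there are CSS codes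
`C_n` on `n = 0, 1, 2, …` qubits (`⌊(1−R)n/2⌋` random `X`-checks and as many random `Z`-checks in their kernel) with
`k_n ≥ R n` such that, at every erasure rate `0 ≤ ε' ≤ ε`, the probability that the erased set `E ~ Ber(ε')` is
uncorrectable for the `Z`-sector or for the `X`-sector tends to `0`.
[cite: BennettDivincenzoSmolin1997, p. 3218 (two bits of redundancy per erased qubit are sufficient; footnote cf2)] -/
theorem exists_cssFamily_quantumErasure_tendsto_zero {ε R : ℝ} (hε : 0 < ε) (hR0 : 0 ≤ R) (h : 2 * ε < 1 - R) :
    ∃ (HX HZ : ∀ n : ℕ, Fin ⌊(1 - R) / 2 * n⌋₊ → Fin n → ZMod 2)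
      (hc : ∀ n, Matrix.of (HX n) * (Matrix.of (HZ n))ᵀ = 0),
      (∀ n : ℕ, R * (n : ℝ) ≤ ((CSSCode.ofMatrices (Matrix.of (HX n)) (Matrix.of (HZ n)) (hc n)).k : ℝ)) ∧
      ∀ ε', 0 ≤ ε' → ε' ≤ ε →
        Tendsto (fun n => eventProb (fun E : Finset (Fin n) =>
          ¬ IsCorrectableErasure
              {x : Fin n → ZMod 2 | (CSSCode.ofMatrices (Matrix.of (HX n)) (Matrix.of (HZ n)) (hc n)).HX *ᵥ x = 0}
              ((CSSCode.ofMatrices (Matrix.of (HX n)) (Matrix.of (HZ n)) (hc n)).rowSpZ : Set (Fin n → ZMod 2)) E ∨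
            ¬ IsCorrectableErasure
              {x : Fin n → ZMod 2 | (CSSCode.ofMatrices (Matrix.of (HX n)) (Matrix.of (HZ n)) (hc n)).HZ *ᵥ x = 0}
              ((CSSCode.ofMatrices (Matrix.of (HX n)) (Matrix.of (HZ n)) (hc n)).rowSpX : Set (Fin n → ZMod 2)) E)
          ε') atTop (𝓝 0) := by
  have hε1 : ε ≤ 1 := by linarith
  obtain ⟨HX, HZ, hc, hk, hbZ, hbX, -, -⟩ := exists_cssFamily_erasure_thresholds_ge (yZ := ε) (yX := ε)
    (ρZ := (1 - R) / 2) (ρX := (1 - R) / 2) (R := R) hε (by linarith) hε (by linarith) hR0 (by linarith)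
  refine ⟨HX, HZ, hc, hk, fun ε' h0 h1 => ?_⟩
  have hZ := hbZ ε' h0 h1
  have hX := hbX ε' h0 h1
  unfold BelowThreshold at hZ hX
  have hsum : Tendsto (fun n =>
      ErasureDecoder.uncorrectableProb
          {x : Fin n → ZMod 2 | (CSSCode.ofMatrices (Matrix.of (HX n)) (Matrix.of (HZ n)) (hc n)).HX *ᵥ x = 0}
          ((CSSCode.ofMatrices (Matrix.of (HX n)) (Matrix.of (HZ n)) (hc n)).rowSpZ : Set (Fin n → ZMod 2)) ε' +
        ErasureDecoder.uncorrectableProb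
          {x : Fin n → ZMod 2 | (CSSCode.ofMatrices (Matrix.of (HX n)) (Matrix.of (HZ n)) (hc n)).HZ *ᵥ x = 0}
          ((CSSCode.ofMatrices (Matrix.of (HX n)) (Matrix.of (HZ n)) (hc n)).rowSpX : Set (Fin n → ZMod 2)) ε')
      atTop (𝓝 0) := by
    simpa using hZ.add hX
  refine squeeze_zero (fun n => eventProb_nonneg _ h0 (h1.trans hε1)) (fun n => ?_) hsum
  exact (CSSCode.ofMatrices (Matrix.of (HX n)) (Matrix.of (HZ n)) (hc n)).quantumErasureFailure_le_add h0
    (h1.trans hε1)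

end Achievability

/-! ### Converse: no CSS family with `k ≥ 1` beats `1 − 2ε` -/

section Converse

variable {RX RZ Q : ℕ → Type*} [∀ i, Fintype (Q i)] [∀ i, DecidableEq (Q i)] [∀ i, Fintype (RX i)]
  [∀ i, Fintype (RZ i)]

open Classical in
/-- **`R ≤ 1 − 2ε` for CSS codes on the erasure channel.** For every family of CSS codes with `k_i ≥ 1` and rate
`≥ R` (`R·n_i ≤ k_i`): if at erasure rate `0 ≤ ε ≤ 1/2` the joint (both sectors, same erased set) failure
probability tends to `0`, then `2ε ≤ 1 − R`. [cite: BennettDivincenzoSmolin1997, p. 3218 (Q ≤ 1 − 2ε; two bits of redundancy per erased qubit are necessary); DelfosseZemor2013, §3 eq. (capacity) and Thm. 3.5] -/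
theorem quantumErasure_rate_le (C : ∀ i, CSSCode (RX i) (RZ i) (Q i)) (hk : ∀ i, 0 < (C i).k) {R : ℝ}
    (hR : ∀ i, R * Fintype.card (Q i) ≤ (C i).k) {ε : ℝ} (h0 : 0 ≤ ε) (h1 : ε ≤ 1 / 2)
    (h : Tendsto (fun i => eventProb (fun E : Finset (Q i) =>
        ¬ IsCorrectableErasure {x : Q i → ZMod 2 | (C i).HX *ᵥ x = 0} ((C i).rowSpZ : Set (Q i → ZMod 2)) E ∨
          ¬ IsCorrectableErasure {x : Q i → ZMod 2 | (C i).HZ *ᵥ x = 0} ((C i).rowSpX : Set (Q i → ZMod 2)) E) ε)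
      atTop (𝓝 0)) :
    2 * ε ≤ 1 - R := by
  have hZ : BelowThreshold
      (fun i y => ErasureDecoder.uncorrectableProb {x : Q i → ZMod 2 | (C i).HX *ᵥ x = 0}
        ((C i).rowSpZ : Set (Q i → ZMod 2)) y) ε :=
    squeeze_zero (fun i => ErasureDecoder.uncorrectableProb_nonneg _ _ h0 (by linarith))
      (fun i => (C i).zUncorrectableProb_le_quantumErasureFailure h0 (by linarith)) h
  have hX : BelowThreshold
      (fun i y => ErasureDecoder.uncorrectableProb {x : Q i → ZMod 2 | (C i).HZ *ᵥ x = 0}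
        ((C i).rowSpX : Set (Q i → ZMod 2)) y) ε :=
    squeeze_zero (fun i => ErasureDecoder.uncorrectableProb_nonneg _ _ h0 (by linarith))
      (fun i => (C i).xUncorrectableProb_le_quantumErasureFailure h0 (by linarith)) h
  have h2 := erasure_rates_add_le_one_sub_rate C hk hR h0 h0 (by linarith) hZ hX
  linarith

open Classical in
/-- **Threshold form: `ε_c ≤ (1 − R)/2`.** For a CSS family with `k_i ≥ 1` and rate `≥ R`, every threshold lower
bound `a ≤ 1` of the joint erasure-channel failure family satisfies `a ≤ (1 − R)/2`, and so does its accuracy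
threshold (first `a ≤ 1/2` by the sector-wise no-cloning bound `erasure_thresholds_add_le_one`, then the rate bound at
an erasure rate between `(1 − R)/2` and `a`). [cite: BennettDivincenzoSmolin1997, p. 3218 (Q = max{0, 1 − 2ε}); DennisEtAl2002, §4.6 (p_c)] -/
theorem quantumErasure_threshold_le_half_sub_rate (C : ∀ i, CSSCode (RX i) (RZ i) (Q i)) (hk : ∀ i, 0 < (C i).k)
    {R : ℝ} (hR : ∀ i, R * Fintype.card (Q i) ≤ (C i).k) {a : ℝ}
    (ha : IsThresholdLowerBound (fun i ε => eventProb (fun E : Finset (Q i) =>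
        ¬ IsCorrectableErasure {x : Q i → ZMod 2 | (C i).HX *ᵥ x = 0} ((C i).rowSpZ : Set (Q i → ZMod 2)) E ∨
          ¬ IsCorrectableErasure {x : Q i → ZMod 2 | (C i).HZ *ᵥ x = 0} ((C i).rowSpX : Set (Q i → ZMod 2)) E) ε)
      a) (ha1 : a ≤ 1) :
    a ≤ (1 - R) / 2 := by
  -- `a` is a threshold lower bound of each sector family
  have haZ : IsThresholdLowerBound
      (fun i y => ErasureDecoder.uncorrectableProb {x : Q i → ZMod 2 | (C i).HX *ᵥ x = 0}
        ((C i).rowSpZ : Set (Q i → ZMod 2)) y) a := fun y hy0 hya =>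
    squeeze_zero (fun i => ErasureDecoder.uncorrectableProb_nonneg _ _ hy0 (by linarith))
      (fun i => (C i).zUncorrectableProb_le_quantumErasureFailure hy0 (by linarith)) (ha y hy0 hya)
  have haX : IsThresholdLowerBound
      (fun i y => ErasureDecoder.uncorrectableProb {x : Q i → ZMod 2 | (C i).HZ *ᵥ x = 0}
        ((C i).rowSpX : Set (Q i → ZMod 2)) y) a := fun y hy0 hya =>
    squeeze_zero (fun i => ErasureDecoder.uncorrectableProb_nonneg _ _ hy0 (by linarith))
      (fun i => (C i).xUncorrectableProb_le_quantumErasureFailure hy0 (by linarith)) (ha y hy0 hya)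
  have hhalf : a ≤ 1 / 2 := by
    have h := erasure_thresholds_add_le_one C hk haZ haX
    linarith
  have hR1 : R ≤ 1 := by
    have hn : (0 : ℝ) < Fintype.card (Q 0) := by
      exact_mod_cast lt_of_lt_of_le (hk 0) (C 0).k_le_card
    have h1 : ((C 0).k : ℝ) ≤ Fintype.card (Q 0) := by exact_mod_cast (C 0).k_le_card
    have h2 : R * Fintype.card (Q 0) ≤ 1 * Fintype.card (Q 0) := by linarith [hR 0]
    exact le_of_mul_le_mul_right h2 hn
  by_contra hlt
  push Not at hlt
  -- an erasure rate strictly between `(1 - R)/2` and `a`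
  set ε : ℝ := ((1 - R) / 2 + a) / 2 with hε
  have hε0 : 0 ≤ ε := by rw [hε]; linarith
  have hεa : ε < a := by rw [hε]; linarith
  have hε2 : ε ≤ 1 / 2 := by rw [hε]; linarith
  have h2 := quantumErasure_rate_le C hk hR hε0 hε2 (ha ε hε0 hεa)
  rw [hε] at h2
  linarith

open Classical in
/-- **Accuracy-threshold form: `ε_c ≤ (1 − R)/2`** for the erasure channel of every CSS family with `k_i ≥ 1` and
rate `≥ R`. [cite: BennettDivincenzoSmolin1997, p. 3218 (Q = max{0, 1 − 2ε}); DennisEtAl2002, §4.6 (p_c)] -/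
theorem quantumErasure_accuracyThreshold_le_half_sub_rate (C : ∀ i, CSSCode (RX i) (RZ i) (Q i))
    (hk : ∀ i, 0 < (C i).k) {R : ℝ} (hR : ∀ i, R * Fintype.card (Q i) ≤ (C i).k) :
    accuracyThreshold (fun i ε => eventProb (fun E : Finset (Q i) =>
        ¬ IsCorrectableErasure {x : Q i → ZMod 2 | (C i).HX *ᵥ x = 0} ((C i).rowSpZ : Set (Q i → ZMod 2)) E ∨
          ¬ IsCorrectableErasure {x : Q i → ZMod 2 | (C i).HZ *ᵥ x = 0} ((C i).rowSpX : Set (Q i → ZMod 2)) E) ε)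
      ≤ (1 - R) / 2 :=
  quantumErasure_threshold_le_half_sub_rate C hk hR (isThresholdLowerBound_accuracyThreshold _)
    (accuracyThreshold_le_one _)

end Converse

end Literature.InformationTheory.QuantumCodes
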